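import Literature.Computability.QuantumComplexity.PermanentSearch
import Literature.Computability.Complexity.TM2PassThrough
import HarnessLib

/-!
# Runs of the AA13 Thm. 4.3 search: relabelled queries, distinct call sites, polynomial sizes

Companion of `PermanentSearch.lean` (the binary search of Aaronson–Arkhipov, *The computational
complexity of linear optics*, Theory of Computing 9 (2013), proof of Thm. 4.3, as an oracle
computation `perLevel mk g n X` parametrised by a query maker `mk`). This file supplies what the
*randomised* use of the search (proof of Thm. 1.1, p. 178: "a `BPP^{NP^O}` machine … fresh coins for
each of the polynomially many oracle calls, and a union bound") needs about its runs:

* (trunk `CplxCore.OracleComp`, generic) `relabel φ c` — the same computation asking `φ q` for `q`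
  (`eval_relabel`, `queryList_relabel`: a run against `O` is a run of `c` against `O ∘ φ`); the
  **prefix-agreement lemma** `queryList_take_eq_of_agree` (two oracles agreeing on the first `t`
  queries of a run produce the same first `t + 1` queries) and `queryList_eq_of_agree`;
  `queryList_iterM`, `queryList_firstM_eq_take`;
* the **canonical maker** `canon` (query = ⟨code of the call site, code of the matrix⟩, both
  recoverable: `canonSite`, `canonMat`, `canon_inj`);
* `sites_perLevel` — **along every run the call sites `(level, phase, round, index)` are pairwise
  distinct** and lie in the box `1 ≤ level ≤ n`, `phase ≤ 2`, `round < n + rounds g n`,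
  `index ≤ 3g` (so each call site can own a block of fresh coins, assigned injectively);
* polynomial bounds: `rounds_le_RB` (`rounds g n ≤ 2(n+1)² + 2g + 3`), `budget_le`,
  `EB_lt_two_pow` / `EBn_lt_two_pow` (entries have `≤ EBits g n` bits), the code-length lemmas
  `length_listBool_encode_le`, `length_encodingIntBool_le`, `length_encode_matrix_le`
  (`|⟨m, M⟩| ≤ LM m b`), `le_length_encode_matrix`, and `queries_perLevel_bounded` — on every run
  the matrices asked for a `0/1` input have codes of length `≤ LM n (EBits g n)`.

All statements are proved; no named facts.

Librarian note (hoist set). The first block (`OracleComp.relabel` and its laws,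
`queryList_take_eq_of_agree`, `queryList_eq_of_agree`, `getElem?_queryList_eq_of_agree`,
`queryList_iterM`, `queryList_firstM_eq_take`) is generic trunk material declared in
`Literature.Computability.Complexity.OracleComp` but living in this `QuantumComplexity` file; its only dependencies beyond
`OracleComputations.lean` are the `PerSearch` copies `queryList_bind_eq`, `queryList_pure_eq`,
`queryList_ask_eq` (`PermanentSearch.lean`, twins of `Cryptography/ShorClassicalOracle.lean`) and
`queryList_firstM_cons`, `queryList_forEach` (`PermanentSearch.lean`). The whole set is destined for
`Complexity/OracleComputations.lean`; a trunk consumer importing only that file does not see it yet.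

## References

* S. Aaronson, A. Arkhipov, *The computational complexity of linear optics*, Theory of Computing 9
  (2013), proof of Thm. 4.3 (pp. 176–177) and proof of Thm. 1.1 (p. 178).
* S. Arora, B. Barak, *Computational Complexity: A Modern Approach*, CUP 2009, §3.4 (oracle
  machines: the configuration is determined by the input and the answers), §0.1 (codes).
-/

namespace Literature.Computability.Complexity.OracleComp

open Complexity

variable {β γ : Type}

/-! ### Relabelling the queries of an oracle computation -/

/-- **Relabelling the queries**: `relabel φ c` asks `φ q` wherever `c` asks `q` (same tree, same
continuations). Running it against `O` is running `c` against `O ∘ φ`. This is how one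
computation is run against a *family* of oracles — e.g. a randomised oracle with the coins of
each call site spliced into the query (Aaronson–Arkhipov 2013, Thm. 1.1, p. 149: the randomised
oracle takes its random string as part of the input). This is the `OracleComp`-level form of the
machine-level device `OracleAlg.mapQuery` of `Complexity/OracleQueryMap.lean` (the special case in
which the rewriting ignores the input and the transcript; `queryList_eq_of_agree` below plays the
role of `OracleAlg.run_mapQuery` under `MapAgree`); the machine side of a consumer uses
`OracleAlg.isPolyTime_mapQuery`. [Arora–Barak 2009, §3.4] [cite: AroraBarak2009, §3.4] -/
def relabel (φ : List Bool → List Bool) : OracleComp β → OracleComp β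
  | pure b => pure b
  | query q k => query (φ q) fun a => relabel φ (k a)

/-- `relabel` of a leaf. [folklore] -/
@[simp] theorem relabel_pure (φ : List Bool → List Bool) (b : β) : relabel φ (pure b : OracleComp β) = pure b := rfl

/-- `relabel` of a query node. [folklore] -/
@[simp] theorem relabel_query (φ : List Bool → List Bool) (q : List Bool) (k : List Bool → OracleComp β) :
    relabel φ (query q k) = query (φ q) fun a => relabel φ (k a) := rfl

/-- **`eval` of a relabelled computation** is `eval` against the composed oracle. [Arora–Barak 2009, §3.4] [cite: AroraBarak2009, §3.4] -/
@[simp] theorem eval_relabel (O : Oracle) (φ : List Bool → List Bool) (c : OracleComp β) :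
    eval O (relabel φ c) = eval (O ∘ φ) c := by
  induction c with
  | pure b => rfl
  | query q k ih => simp only [relabel_query, eval_query, Function.comp_apply, ih]

/-- **The queries of a relabelled computation** are the relabelled queries of the run against the
composed oracle. [Arora–Barak 2009, §3.4] [cite: AroraBarak2009, §3.4] -/
@[simp] theorem queryList_relabel (O : Oracle) (φ : List Bool → List Bool) (c : OracleComp β) :
    queryList O (relabel φ c) = (queryList (O ∘ φ) c).map φ := by
  induction c with
  | pure b => rfl
  | query q k ih => simp only [relabel_query, queryList, Function.comp_apply, ih, List.map_cons]

/-- The query count is unchanged by relabelling (against the composed oracle). [folklore] -/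
@[simp] theorem queryCount_relabel (O : Oracle) (φ : List Bool → List Bool) (c : OracleComp β) :
    queryCount O (relabel φ c) = queryCount (O ∘ φ) c := by
  induction c with
  | pure b => rfl
  | query q k ih => simp only [relabel_query, queryCount, Function.comp_apply, ih]

/-- `relabel` commutes with `bind`. [folklore] -/
@[simp] theorem relabel_bind (φ : List Bool → List Bool) (c : OracleComp β) (f : β → OracleComp γ) :
    relabel φ (OracleComp.bind c f) = OracleComp.bind (relabel φ c) fun b => relabel φ (f b) := by
  induction c with
  | pure b => rfl
  | query q k ih => simp only [OracleComp.bind, relabel_query, ih]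

/-! ### Two oracles that agree on a prefix of the run -/

/-- **Prefix agreement**: if two oracles give the same answers to the first `t` queries of the
run of `c` against the first, then the two runs ask the same first `t + 1` queries (the run is
determined by the answers received so far). [Arora–Barak 2009, §3.4 (the configuration after `i`
answers depends only on the input and those answers)] [cite: AroraBarak2009, §3.4] -/
theorem queryList_take_eq_of_agree (O₁ O₂ : Oracle) :
    ∀ (c : OracleComp β) (t : ℕ),
      (∀ s < t, ∀ q, (queryList O₁ c)[s]? = some q → O₁ q = O₂ q) →
        (queryList O₁ c).take (t + 1) = (queryList O₂ c).take (t + 1)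
  | pure b, t, _ => rfl
  | query q k, 0, _ => by simp [queryList]
  | query q k, t + 1, h => by
    have hq : O₁ q = O₂ q := h 0 (Nat.zero_lt_succ _) q (by simp [queryList])
    simp only [queryList, List.take_succ_cons, List.cons.injEq, true_and]
    rw [← hq]
    refine queryList_take_eq_of_agree O₁ O₂ (k (O₁ q)) t fun s hs q' hq' => h (s + 1) (by omega) q' ?_
    simpa [queryList] using hq'

/-- **Full agreement**: if the two oracles agree on every query of the run against the first, the
runs coincide — same queries, same result. [Arora–Barak 2009, §3.4] [cite: AroraBarak2009, §3.4] -/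
theorem queryList_eq_of_agree (O₁ O₂ : Oracle) :
    ∀ c : OracleComp β, (∀ q ∈ queryList O₁ c, O₁ q = O₂ q) →
      queryList O₁ c = queryList O₂ c ∧ eval O₁ c = eval O₂ c
  | pure b, _ => ⟨rfl, rfl⟩
  | query q k, h => by
    have hq : O₁ q = O₂ q := h q (by simp [queryList])
    have ih := queryList_eq_of_agree O₁ O₂ (k (O₁ q)) fun q' hq' => h q' (by simp [queryList, hq'])
    simp only [queryList, eval_query, ← hq, ih.1, ih.2, and_self]

/-- The `s`-th query of a run, if answered identically by a second oracle for all earlier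
queries, is also the `s`-th query of the run against the second oracle. [folklore] -/
theorem getElem?_queryList_eq_of_agree (O₁ O₂ : Oracle) (c : OracleComp β) (t : ℕ)
    (h : ∀ s < t, ∀ q, (queryList O₁ c)[s]? = some q → O₁ q = O₂ q) :
    (queryList O₂ c)[t]? = (queryList O₁ c)[t]? := by
  have ht := queryList_take_eq_of_agree O₁ O₂ c t h
  have h1 : ((queryList O₁ c).take (t + 1))[t]? = (queryList O₁ c)[t]? := List.getElem?_take_of_lt (by omega)
  have h2 : ((queryList O₂ c).take (t + 1))[t]? = (queryList O₂ c)[t]? := List.getElem?_take_of_lt (by omega)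
  rw [← h1, ← h2, ht]

/-! ### Query lists of the loop combinators -/

/-- The queries of a bounded loop: those of the body at the successive states. [folklore] -/
theorem queryList_iterM (O : Oracle) {σ : Type} (f : σ → OracleComp σ) :
    ∀ (n : ℕ) (s : σ), queryList O (iterM f n s) =
      (List.range n).flatMap fun t => queryList O (f ((fun s => eval O (f s))^[t] s))
  | 0, s => by simp [iterM]
  | n + 1, s => by
    rw [iterM, Literature.Computability.QuantumComplexity.PerSearch.queryList_bind_eq, queryList_iterM O f n,
      List.range_succ_eq_map, List.flatMap_cons]
    congr 1
    rw [List.flatMap_map]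
    rfl

/-- The queries of `firstM`: those of the items tried, an initial segment of the list. [folklore] -/
theorem queryList_firstM_eq_take (O : Oracle) {α : Type} (f : α → OracleComp (Option γ)) :
    ∀ l : List α, ∃ m ≤ l.length, queryList O (firstM f l) = (l.take m).flatMap fun a => queryList O (f a)
  | [] => ⟨0, le_rfl, rfl⟩
  | a :: l => by
    rw [Literature.Computability.QuantumComplexity.PerSearch.queryList_firstM_cons]
    cases eval O (f a) with
    | some b => exact ⟨1, by simp, by simp⟩
    | none =>
      obtain ⟨m, hm, hq⟩ := queryList_firstM_eq_take O f l
      exact ⟨m + 1, by simpa using hm, by simp [hq]⟩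

end Literature.Computability.Complexity.OracleComp

namespace Literature.Computability.QuantumComplexity

open _root_.Computability Complexity Complexity.OracleComp Matrix Finset

namespace PerSearch

/-! ### The canonical query maker: the call site and the matrix, both recoverable -/

/-- Code of a call site `(level, phase, round, index)`: nested pairs of binary numerals. [folklore] -/
def siteCode (s : Site) : List Bool :=
  boolPair (encodeNat s.1) (boolPair (encodeNat s.2.1) (boolPair (encodeNat s.2.2.1) (encodeNat s.2.2.2)))

/-- Decoding a site code. [folklore] -/
def siteDecode (w : List Bool) : Site :=
  (decodeNat (boolUnpair w).1, decodeNat (boolUnpair (boolUnpair w).2).1,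
    decodeNat (boolUnpair (boolUnpair (boolUnpair w).2).2).1, decodeNat (boolUnpair (boolUnpair (boolUnpair w).2).2).2)

/-- `siteDecode` inverts `siteCode`. [folklore] -/
@[simp] theorem siteDecode_siteCode (s : Site) : siteDecode (siteCode s) = s := by
  obtain ⟨a, b, c, d⟩ := s
  simp [siteCode, siteDecode, decode_encodeNat]

/-- **The canonical query maker**: the query at site `s` for the matrix `M` is `⟨code of s, code of M⟩`,
so that both the site and the matrix can be read off the query (the randomised maker of
`PermanentSearchRandom.lean` is obtained from it by relabelling). [cite: AaronsonArkhipovToC2013, proof of Thm. 1.1 (p. 178)] -/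
def canon : Maker := fun s M => boolPair (siteCode s) (encodingIntMatrix.encode M)

/-- The site of a canonical query. [folklore] -/
def canonSite (q : List Bool) : Site := siteDecode (boolUnpair q).1

/-- The matrix of a canonical query (`none` on junk). [folklore] -/
def canonMat (q : List Bool) : Option (Σ n : ℕ, Fin n → Fin n → ℤ) := encodingIntMatrix.decode (boolUnpair q).2

/-- Reading the site off a canonical query. [folklore] -/
@[simp] theorem canonSite_canon (s : Site) (M : Σ n : ℕ, Fin n → Fin n → ℤ) : canonSite (canon s M) = s := by
  simp [canonSite, canon]

/-- Reading the matrix off a canonical query. [folklore] -/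
@[simp] theorem canonMat_canon (s : Site) (M : Σ n : ℕ, Fin n → Fin n → ℤ) : canonMat (canon s M) = some M := by
  simp [canonMat, canon, encodingIntMatrix.decode_encode]

/-- The canonical maker is injective in (site, matrix). [folklore] -/
theorem canon_inj {s s' : Site} {M M' : Σ n : ℕ, Fin n → Fin n → ℤ} (h : canon s M = canon s' M') :
    s = s' ∧ M = M' := by
  have h1 := congr_arg canonSite h
  have h2 := congr_arg canonMat h
  simp only [canonSite_canon, canonMat_canon, Option.some.injEq] at h1 h2
  exact ⟨h1, h2⟩

/-! ### The call sites of a run are distinct -/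

section Sites

variable {g : ℕ}

/-- The sites of `askV canon`. [folklore] -/
@[simp] theorem map_canonSite_queryList_askV (O : Oracle) (s : Site) {m : ℕ} (X : Matrix (Fin m) (Fin m) ℤ) :
    (queryList O (askV canon s X)).map canonSite = [s] := by
  simp

/-- The sites of `askMinor canon`: none or the one site. [folklore] -/
theorem map_canonSite_queryList_askMinor (O : Oracle) (s : Site) {m : ℕ} (Y : Matrix (Fin m) (Fin m) ℤ) :
    (queryList O (askMinor canon s Y)).map canonSite = [] ∨ (queryList O (askMinor canon s Y)).map canonSite = [s] := by
  cases m with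
  | zero => left; rfl
  | succ m => right; simp [askMinor]

/-- The round counter advances by one in every search round. [folklore] -/
theorem eval_searchRound_fst (mk : Maker) (g : ℕ) (O : Oracle) (lvl : ℕ) {n : ℕ} (X : Matrix (Fin (n + 1)) (Fin (n + 1)) ℤ)
    (PY : ℕ) (st : ℕ × ℚ × ℕ) : (eval O (searchRound mk g lvl X PY st)).1 = st.1 + 1 := by
  unfold searchRound
  split_ifs <;> simp

/-- After `t` rounds the round counter is `st.1 + t`. [folklore] -/
theorem iterate_searchRound_fst (mk : Maker) (g : ℕ) (O : Oracle) (lvl : ℕ) {n : ℕ} (X : Matrix (Fin (n + 1)) (Fin (n + 1)) ℤ)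
    (PY : ℕ) (t : ℕ) (st : ℕ × ℚ × ℕ) :
    ((fun st => eval O (searchRound mk g lvl X PY st))^[t] st).1 = st.1 + t := by
  induction t generalizing st with
  | zero => rfl
  | succ t ih => rw [Function.iterate_succ_apply, ih, eval_searchRound_fst]; omega

/-- The sites of one search round: none, or `(lvl, 2, round, i)` for `i = 0, …, 3g`. [folklore] -/
theorem map_canonSite_queryList_searchRound (O : Oracle) (lvl : ℕ) {n : ℕ} (X : Matrix (Fin (n + 1)) (Fin (n + 1)) ℤ)
    (PY : ℕ) (st : ℕ × ℚ × ℕ) :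
    (queryList O (searchRound canon g lvl X PY st)).map canonSite =
      if st.2.2 = 0 then [] else (List.range (3 * g + 1)).map fun i => (lvl, 2, st.1, i) := by
  unfold searchRound
  split_ifs with h
  · rfl
  · rw [queryList_bind_eq, queryList_forEach]
    simp only [queryList_bind_eq, queryList_askV, eval_askV, queryList_pure_eq, List.append_nil,
      List.map_flatMap, List.map_cons, List.map_nil, canonSite_canon]
    exact List.map_eq_flatMap.symm

/-- A `flatMap` each of whose items contributes nothing or the one value `f a` is a sublist of
`map f` (a two-line instance of Mathlib's `List.Sublist` calculus, kept local). [folklore] -/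
private theorem flatMap_sublist_map {α δ : Type} (l : List α) (F : α → List δ) (f : α → δ)
    (h : ∀ a ∈ l, F a = [] ∨ F a = [f a]) : (l.flatMap F).Sublist (l.map f) := by
  induction l with
  | nil => simp
  | cons a l ih =>
    rw [List.flatMap_cons, List.map_cons]
    have ih' := ih fun a' ha' => h a' (List.mem_cons_of_mem _ ha')
    rcases h a List.mem_cons_self with h0 | h1
    · rw [h0, List.nil_append]; exact ih'.trans (List.sublist_cons_self _ _)
    · rw [h1, List.singleton_append]; exact ih'.cons_cons _

/-- The pivot-phase sites of level `n + 1`: `(n+1, 1, p, 0)`, `p ≤ n`. [folklore] -/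
def IsPivotSite (n : ℕ) (s : Site) : Prop := s.1 = n + 1 ∧ s.2.1 = 1 ∧ s.2.2.1 ≤ n ∧ s.2.2.2 = 0

/-- The box of the sites of a level-`n` search: `1 ≤ level ≤ n`, `phase ≤ 2`,
`round < n + rounds g n`, `index ≤ 3g`. [folklore] -/
def InSiteBox (g n : ℕ) (s : Site) : Prop := 1 ≤ s.1 ∧ s.1 ≤ n ∧ s.2.1 ≤ 2 ∧ s.2.2.1 < n + rounds g n ∧ s.2.2.2 ≤ 3 * g

/-- The search-phase sites of level `n + 1`: `(n+1, 2, t, i)`, `t < rounds g n`, `i ≤ 3g`. [folklore] -/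
def IsSearchSite (g n : ℕ) (s : Site) : Prop := s.1 = n + 1 ∧ s.2.1 = 2 ∧ s.2.2.1 < rounds g n ∧ s.2.2.2 ≤ 3 * g

/-- The pivot phase: distinct sites, all pivot sites (`IsPivotSite`). [folklore] -/
theorem sites_pivotPhase (O : Oracle) {n : ℕ} (X : Matrix (Fin (n + 1)) (Fin (n + 1)) ℤ) :
    let F : Fin (n + 1) → OracleComp (Option (Fin (n + 1))) := fun p =>
      if X p 0 ≠ 1 then OracleComp.pure none else
        OracleComp.bind (askMinor canon (n + 1, 1, (p : ℕ), 0) (X.submatrix p.succAbove Fin.succ)) fun b =>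
          OracleComp.pure (if b = 0 then none else some p)
    ((queryList O (firstM F (List.finRange (n + 1)))).map canonSite).Nodup ∧
      ∀ s ∈ (queryList O (firstM F (List.finRange (n + 1)))).map canonSite, IsPivotSite n s := by
  intro F
  obtain ⟨m, _, hq⟩ := queryList_firstM_eq_take O F (List.finRange (n + 1))
  rw [hq, List.map_flatMap]
  set f : Fin (n + 1) → Site := fun p => (n + 1, 1, (p : ℕ), 0) with hf
  have hsub : (((List.finRange (n + 1)).take m).flatMap fun p => (queryList O (F p)).map canonSite).Sublist
      (((List.finRange (n + 1)).take m).map f) := by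
    refine flatMap_sublist_map _ _ f fun p _ => ?_
    simp only [F]
    split_ifs
    · left; rfl
    · rw [queryList_bind_eq, queryList_pure_eq, List.append_nil]
      exact map_canonSite_queryList_askMinor O _ _
  have hnd : (((List.finRange (n + 1)).take m).map f).Nodup := by
    refine List.Nodup.map (fun p p' h => ?_) ((List.nodup_finRange (n + 1)).sublist (List.take_sublist _ _))
    simp only [hf, Prod.mk.injEq] at h
    exact Fin.ext h.2.2.1
  refine ⟨hnd.sublist hsub, fun s hs => ?_⟩
  obtain ⟨p, _, rfl⟩ := List.mem_map.1 (hsub.subset hs)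
  exact ⟨rfl, rfl, Nat.lt_succ_iff.1 p.isLt, rfl⟩

/-- The search phase: distinct sites, all search sites (`IsSearchSite`). [folklore] -/
theorem sites_searchPhase (O : Oracle) {n : ℕ} (X' : Matrix (Fin (n + 1)) (Fin (n + 1)) ℤ) (PY v0 : ℕ) :
    ((queryList O (iterM (searchRound canon g (n + 1) X' PY) (rounds g n) (0, 0, v0))).map canonSite).Nodup ∧
      ∀ s ∈ (queryList O (iterM (searchRound canon g (n + 1) X' PY) (rounds g n) (0, 0, v0))).map canonSite,
        IsSearchSite g n s := by
  rw [queryList_iterM, List.map_flatMap]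
  set body : ℕ × ℚ × ℕ → ℕ × ℚ × ℕ := fun st => eval O (searchRound canon g (n + 1) X' PY st) with hbody_def
  have hbody : ∀ t : ℕ, (queryList O (searchRound canon g (n + 1) X' PY (body^[t] (0, 0, v0)))).map canonSite =
      if (body^[t] (0, 0, v0)).2.2 = 0 then [] else (List.range (3 * g + 1)).map fun i => (n + 1, 2, t, i) := by
    intro t
    rw [map_canonSite_queryList_searchRound, hbody_def, iterate_searchRound_fst, zero_add]
  simp only [hbody]
  constructor
  · rw [List.nodup_flatMap]
    constructor
    · intro t _
      split_ifs
      · exact List.nodup_nil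
      · exact List.Nodup.map (fun i i' h => by simpa using h) (List.nodup_range)
    · refine (List.pairwise_lt_range).imp fun {a b} hab => ?_
      refine List.disjoint_left.2 fun s hsa hsb => ?_
      by_cases ha : (body^[a] (0, 0, v0)).2.2 = 0
      · simp [ha] at hsa
      by_cases hb : (body^[b] (0, 0, v0)).2.2 = 0
      · simp [hb] at hsb
      simp only [ha, hb, if_false, List.mem_map, List.mem_range] at hsa hsb
      obtain ⟨i, _, rfl⟩ := hsa
      obtain ⟨i', _, h⟩ := hsb
      simp only [Prod.mk.injEq] at h
      omega
  · intro s hs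
    obtain ⟨t, ht, hs⟩ := List.mem_flatMap.1 hs
    by_cases h0 : (body^[t] (0, 0, v0)).2.2 = 0
    · simp [h0] at hs
    · simp only [h0, if_false, List.mem_map] at hs
      obtain ⟨i, hi, rfl⟩ := hs
      exact ⟨rfl, rfl, List.mem_range.1 ht, Nat.lt_succ_iff.1 (List.mem_range.1 hi)⟩

/-- **The call sites of the search are pairwise distinct, and lie in a polynomial box**: along every
run of `perLevel canon g n X` (any oracle), the sites `(level, phase, round, index)` of the queries
are pairwise distinct, with `1 ≤ level ≤ n`, `phase ≤ 2`, `round < n + rounds g n`, `index ≤ 3g`.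
(Level `n + 1` asks `(n+1, 0, 0, 0)`, then `(n+1, 1, p, 0)` for increasing pivots `p`, then the
sites of level `n`, then `(n+1, 2, t, i)` round by round.) This is what lets each call site own a
block of fresh coins. [cite: AaronsonArkhipovToC2013, proof of Thm. 1.1 (p. 178) with proof of Thm. 4.3 (pp. 176–177)] -/
theorem sites_perLevel :
    ∀ (n : ℕ) (X : Matrix (Fin n) (Fin n) ℤ) (O : Oracle),
      ((queryList O (perLevel canon g n X)).map canonSite).Nodup ∧
        ∀ s ∈ (queryList O (perLevel canon g n X)).map canonSite, InSiteBox g n s := by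
  intro n
  induction n with
  | zero => intro X O; simp [perLevel]
  | succ n ih =>
    intro X O
    have hrm : rounds g n ≤ rounds g (n + 1) := rounds_mono (Nat.le_succ n)
    -- classes exclude each other
    have h12 : ∀ s, IsPivotSite n s → InSiteBox g n s → False := fun s h1 h2 => by simp only [IsPivotSite, InSiteBox] at h1 h2; omega
    have h13 : ∀ s, IsPivotSite n s → IsSearchSite g n s → False := fun s h1 h3 => by simp only [IsPivotSite, IsSearchSite] at h1 h3; omega
    have h23 : ∀ s, InSiteBox g n s → IsSearchSite g n s → False := fun s h2 h3 => by simp only [InSiteBox, IsSearchSite] at h2 h3; omega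
    have hbox : ∀ s, (IsPivotSite n s ∨ InSiteBox g n s ∨ IsSearchSite g n s) → InSiteBox g (n + 1) s := fun s h => by
      simp only [IsPivotSite, InSiteBox, IsSearchSite] at h ⊢; omega
    -- the rest of the site list, after the first query: distinct sites, each a pivot site, in the level-`n` box, or a search site
    suffices hrest : ∀ v0 : ℕ,
        ((queryList O (if v0 = 0 then OracleComp.pure 0 else
          OracleComp.bind
            (firstM (fun p : Fin (n + 1) =>
                if X p 0 ≠ 1 then OracleComp.pure none else
                  OracleComp.bind (askMinor canon (n + 1, 1, (p : ℕ), 0) (X.submatrix p.succAbove Fin.succ)) fun b =>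
                    OracleComp.pure (if b = 0 then none else some p))
              (List.finRange (n + 1)))
            fun piv =>
              match piv with
              | none => OracleComp.pure 0
              | some p =>
                OracleComp.bind (perLevel canon g n ((X.submatrix (Fin.cons p p.succAbove) id).submatrix Fin.succ Fin.succ))
                  fun PY =>
                    if PY = 0 ∨ n.factorial < PY then OracleComp.pure 0 else
                      OracleComp.bind
                        (iterM (searchRound canon g (n + 1) (X.submatrix (Fin.cons p p.succAbove) id) PY)
                          (rounds g n) (0, 0, v0))
                        fun st => OracleComp.pure (round (st.2.1 * PY)).toNat)).map canonSite).Nodup ∧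
        ∀ s ∈ (queryList O (if v0 = 0 then OracleComp.pure 0 else
          OracleComp.bind
            (firstM (fun p : Fin (n + 1) =>
                if X p 0 ≠ 1 then OracleComp.pure none else
                  OracleComp.bind (askMinor canon (n + 1, 1, (p : ℕ), 0) (X.submatrix p.succAbove Fin.succ)) fun b =>
                    OracleComp.pure (if b = 0 then none else some p))
              (List.finRange (n + 1)))
            fun piv =>
              match piv with
              | none => OracleComp.pure 0
              | some p =>
                OracleComp.bind (perLevel canon g n ((X.submatrix (Fin.cons p p.succAbove) id).submatrix Fin.succ Fin.succ))
                  fun PY =>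
                    if PY = 0 ∨ n.factorial < PY then OracleComp.pure 0 else
                      OracleComp.bind
                        (iterM (searchRound canon g (n + 1) (X.submatrix (Fin.cons p p.succAbove) id) PY)
                          (rounds g n) (0, 0, v0))
                        fun st => OracleComp.pure (round (st.2.1 * PY)).toNat)).map canonSite,
          IsPivotSite n s ∨ InSiteBox g n s ∨ IsSearchSite g n s by
      simp only [perLevel, queryList_bind_eq, queryList_askV, eval_askV, List.map_cons,
        canonSite_canon, List.singleton_append]
      obtain ⟨hnd, hcls⟩ := hrest (decodeNat (O (canon (n + 1, 0, 0, 0) ⟨n + 1, fun a b => X a b⟩)))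
      refine ⟨List.nodup_cons.2 ⟨fun hmem => ?_, hnd⟩, fun s hs => ?_⟩
      · rcases hcls _ hmem with h | h | h
        · simp only [IsPivotSite] at h; omega
        · simp only [InSiteBox] at h; omega
        · simp only [IsSearchSite] at h; omega
      · rcases List.mem_cons.1 hs with rfl | hs
        · simp only [InSiteBox]; omega
        · exact hbox s (hcls s hs)
    intro v0
    by_cases hz : v0 = 0
    · subst hz; simp
    simp only [hz, if_false, queryList_bind_eq, List.map_append]
    obtain ⟨hnd1, hcls1⟩ := sites_pivotPhase O X
    set F : Fin (n + 1) → OracleComp (Option (Fin (n + 1))) := fun p =>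
      if X p 0 ≠ 1 then OracleComp.pure none else
        OracleComp.bind (askMinor canon (n + 1, 1, (p : ℕ), 0) (X.submatrix p.succAbove Fin.succ)) fun b =>
          OracleComp.pure (if b = 0 then none else some p) with hF
    -- the part after the pivot phase: level-`n` box or search sites, distinct
    have hrest2 : ∀ piv : Option (Fin (n + 1)),
        ((queryList O (match piv with
            | none => OracleComp.pure 0
            | some p =>
              OracleComp.bind (perLevel canon g n ((X.submatrix (Fin.cons p p.succAbove) id).submatrix Fin.succ Fin.succ))
                fun PY =>
                  if PY = 0 ∨ n.factorial < PY then OracleComp.pure 0 else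
                    OracleComp.bind
                      (iterM (searchRound canon g (n + 1) (X.submatrix (Fin.cons p p.succAbove) id) PY)
                        (rounds g n) (0, 0, v0))
                      fun st => OracleComp.pure (round (st.2.1 * PY)).toNat)).map canonSite).Nodup ∧
        ∀ s ∈ (queryList O (match piv with
            | none => OracleComp.pure 0
            | some p =>
              OracleComp.bind (perLevel canon g n ((X.submatrix (Fin.cons p p.succAbove) id).submatrix Fin.succ Fin.succ))
                fun PY =>
                  if PY = 0 ∨ n.factorial < PY then OracleComp.pure 0 else
                    OracleComp.bind
                      (iterM (searchRound canon g (n + 1) (X.submatrix (Fin.cons p p.succAbove) id) PY)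
                        (rounds g n) (0, 0, v0))
                      fun st => OracleComp.pure (round (st.2.1 * PY)).toNat)).map canonSite, InSiteBox g n s ∨ IsSearchSite g n s := by
      intro piv
      cases piv with
      | none => simp
      | some p =>
        dsimp only
        rw [queryList_bind_eq, List.map_append]
        obtain ⟨hnd2, hcls2⟩ := ih ((X.submatrix (Fin.cons p p.succAbove) id).submatrix Fin.succ Fin.succ) O
        generalize eval O (perLevel canon g n ((X.submatrix (Fin.cons p p.succAbove) id).submatrix Fin.succ Fin.succ)) = PY
        by_cases hc : PY = 0 ∨ n.factorial < PY
        · simp only [hc, if_true, queryList_pure_eq, List.map_nil, List.append_nil]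
          exact ⟨hnd2, fun s hs => Or.inl (hcls2 s hs)⟩
        · simp only [hc, if_false, queryList_bind_eq, queryList_pure_eq, List.append_nil]
          obtain ⟨hnd3, hcls3⟩ := sites_searchPhase (g := g) O (X.submatrix (Fin.cons p p.succAbove) id) PY v0
          refine ⟨List.nodup_append.2 ⟨hnd2, hnd3, ?_⟩, fun s hs => ?_⟩
          · intro s hs2 s' hs3 hss'
            subst hss'
            exact h23 s (hcls2 s hs2) (hcls3 s hs3)
          · rcases List.mem_append.1 hs with hs | hs
            · exact Or.inl (hcls2 s hs)
            · exact Or.inr (hcls3 s hs)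
    obtain ⟨hnd2, hcls2⟩ := hrest2 (eval O (firstM F (List.finRange (n + 1))))
    refine ⟨List.nodup_append.2 ⟨hnd1, hnd2, ?_⟩, fun s hs => ?_⟩
    · intro s hs1 s' hs2 hss'
      subst hss'
      rcases hcls2 s hs2 with h | h
      · exact h12 s (hcls1 s hs1) h
      · exact h13 s (hcls1 s hs1) h
    · rcases List.mem_append.1 hs with hs | hs
      · exact Or.inl (hcls1 s hs)
      · exact Or.inr (hcls2 s hs)

end Sites

end PerSearch

end Literature.Computability.QuantumComplexity

namespace Literature.Computability.QuantumComplexity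

open _root_.Computability Complexity Complexity.OracleComp Matrix Finset

namespace PerSearch

/-! ### Polynomial bounds: rounds, queries, entry bits, code lengths -/

section Bounds

variable (g : ℕ)

/-- A polynomial bound for the number of rounds: `RB g n = 2(n+1)² + 2g + 3`. [folklore] -/
def RB (n : ℕ) : ℕ := 2 * (n + 1) ^ 2 + 2 * g + 3

/-- A polynomial bound for the bits of the entries asked: `EBits g n`. [folklore] -/
def EBits (n : ℕ) : ℕ := (2 * g + (n + 1) ^ 2) * RB g n + (RB g n + g + (n + 1) ^ 2 + 1)

variable {g}

/-- `(n+1)! < 2^{(n+1)²}`. [folklore] -/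
theorem factorial_succ_lt_two_pow_sq (n : ℕ) : (n + 1).factorial < 2 ^ ((n + 1) ^ 2) := by
  have h1 : ∀ m : ℕ, m.factorial ≤ m ^ m := by
    intro m
    induction m with
    | zero => simp
    | succ m ih =>
      rw [Nat.factorial_succ, pow_succ']
      exact Nat.mul_le_mul_left _ (ih.trans (Nat.pow_le_pow_left (Nat.le_succ m) m))
  calc (n + 1).factorial ≤ (n + 1) ^ (n + 1) := h1 (n + 1)
    _ < (2 ^ (n + 1)) ^ (n + 1) := Nat.pow_lt_pow_left Nat.lt_two_pow_self (Nat.succ_ne_zero n)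
    _ = 2 ^ ((n + 1) ^ 2) := by rw [← pow_mul, sq]

/-- `3g < 4^g`. [folklore] -/
theorem three_mul_lt_four_pow (g : ℕ) : 3 * g < 4 ^ g := by
  induction g with
  | zero => simp
  | succ g ih =>
    have h4 : 1 ≤ 4 ^ g := Nat.one_le_pow _ _ (by norm_num)
    rw [pow_succ]; omega

/-- `g² < 4^g = 2^{2g}`. [folklore] -/
theorem sq_lt_two_pow_two_mul (g : ℕ) : g ^ 2 < 2 ^ (2 * g) := by
  rw [pow_mul, show (2 : ℕ) ^ 2 = 4 by norm_num, sq]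
  rcases Nat.eq_zero_or_pos g with rfl | hg
  · simp
  · calc g * g < 2 ^ g * 2 ^ g := Nat.mul_lt_mul'' Nat.lt_two_pow_self Nat.lt_two_pow_self
      _ = 4 ^ g := by rw [← mul_pow]; norm_num

/-- **The number of rounds is polynomially bounded**: `rounds g n ≤ RB g n`. [cite: AaronsonArkhipovToC2013, proof of Thm. 4.3, eqs. (4.16)–(4.18) (p. 177)] -/
theorem rounds_le_RB (hg : 1 ≤ g) (n : ℕ) : rounds g n ≤ RB g n := by
  unfold rounds RB
  have hA : 4 * g ^ 2 * (n + 1).factorial ^ 2 < 2 ^ (2 * g + 2 + 2 * (n + 1) ^ 2) := by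
    have h1 : g ^ 2 < 2 ^ (2 * g) := sq_lt_two_pow_two_mul g
    have h2 : (n + 1).factorial ^ 2 < (2 ^ ((n + 1) ^ 2)) ^ 2 :=
      Nat.pow_lt_pow_left (factorial_succ_lt_two_pow_sq n) two_ne_zero
    calc 4 * g ^ 2 * (n + 1).factorial ^ 2 < 4 * 2 ^ (2 * g) * (2 ^ ((n + 1) ^ 2)) ^ 2 := by
          have hf : 0 < (n + 1).factorial ^ 2 := by positivity
          have h3 : 4 * g ^ 2 * (n + 1).factorial ^ 2 < 4 * 2 ^ (2 * g) * (n + 1).factorial ^ 2 :=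
            Nat.mul_lt_mul_of_pos_right (Nat.mul_lt_mul_of_pos_left h1 (by norm_num)) hf
          exact h3.trans_le (Nat.mul_le_mul_left _ h2.le)
      _ = 2 ^ (2 * g + 2 + 2 * (n + 1) ^ 2) := by
          rw [show (4 : ℕ) = 2 ^ 2 by norm_num, ← pow_mul, ← pow_add, ← pow_add]; ring_nf
  have hA0 : 4 * g ^ 2 * (n + 1).factorial ^ 2 ≠ 0 := by positivity
  have hlog := Nat.log_lt_of_lt_pow hA0 hA
  omega

/-- `RB` is monotone. [folklore] -/
theorem RB_mono {m n : ℕ} (h : m ≤ n) : RB g m ≤ RB g n := by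
  unfold RB
  have : (m + 1) ^ 2 ≤ (n + 1) ^ 2 := Nat.pow_le_pow_left (by omega) 2
  omega

/-- **The query budget is polynomially bounded**: `budget g n ≤ n (n + 2 + RB g n (3g + 1))`. [cite: AaronsonArkhipovToC2013, proof of Thm. 4.3 ("O(gn² log n) adaptive queries") (p. 176)] -/
theorem budget_le (hg : 1 ≤ g) : ∀ n : ℕ, budget g n ≤ n * (n + 2 + RB g n * (3 * g + 1))
  | 0 => by simp [budget]
  | n + 1 => by
    rw [budget]
    have ih := budget_le hg n
    have hr := rounds_le_RB hg n
    have hRB : RB g n ≤ RB g (n + 1) := RB_mono (Nat.le_succ n)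
    have h1 : rounds g n * (3 * g + 1) ≤ RB g (n + 1) * (3 * g + 1) := Nat.mul_le_mul_right _ (hr.trans hRB)
    have h2 : n * (n + 2 + RB g n * (3 * g + 1)) ≤ n * (n + 2 + RB g (n + 1) * (3 * g + 1)) :=
      Nat.mul_le_mul_left _ (by have := Nat.mul_le_mul_right (3 * g + 1) hRB; omega)
    have h3 : (n + 1) * (n + 1 + 2 + RB g (n + 1) * (3 * g + 1)) =
        n * (n + 2 + RB g (n + 1) * (3 * g + 1)) + (2 * n + 3 + RB g (n + 1) * (3 * g + 1)) := by ring
    rw [h3]; omega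

/-- **The entries asked have polynomially many bits**: `EB g n < 2^{EBits g n}`. [folklore] -/
theorem EB_lt_two_pow (hg : 1 ≤ g) (n : ℕ) : EB g n < 2 ^ EBits g n := by
  unfold EB EBits
  set T := rounds g n with hT
  have hTR : T ≤ RB g n := rounds_le_RB hg n
  have hfac := factorial_succ_lt_two_pow_sq n
  have hbase : 3 * g * (n + 1).factorial < 2 ^ (2 * g + (n + 1) ^ 2) := by
    have h3 : 3 * g < 2 ^ (2 * g) := by
      rw [pow_mul, show (2 : ℕ) ^ 2 = 4 by norm_num]; exact three_mul_lt_four_pow g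
    rw [pow_add]
    exact Nat.mul_lt_mul'' h3 hfac
  have hpow : (3 * g * (n + 1).factorial) ^ T ≤ 2 ^ ((2 * g + (n + 1) ^ 2) * RB g n) := by
    calc (3 * g * (n + 1).factorial) ^ T ≤ (2 ^ (2 * g + (n + 1) ^ 2)) ^ T := Nat.pow_le_pow_left hbase.le T
      _ ≤ (2 ^ (2 * g + (n + 1) ^ 2)) ^ RB g n := Nat.pow_le_pow_right (by positivity) hTR
      _ = 2 ^ ((2 * g + (n + 1) ^ 2) * RB g n) := by rw [← pow_mul]
  have hsecond : 2 + T * (g * (n + 1).factorial + 1) < 2 ^ (RB g n + g + (n + 1) ^ 2 + 1) := by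
    have h1 : g * (n + 1).factorial + 1 ≤ 2 ^ (g + (n + 1) ^ 2) := by
      have : g * (n + 1).factorial < 2 ^ g * 2 ^ ((n + 1) ^ 2) := Nat.mul_lt_mul'' Nat.lt_two_pow_self hfac
      rw [pow_add]; omega
    have h2 : T < 2 ^ RB g n := hTR.trans_lt Nat.lt_two_pow_self
    have h3 : T * (g * (n + 1).factorial + 1) < 2 ^ RB g n * 2 ^ (g + (n + 1) ^ 2) :=
      Nat.mul_lt_mul_of_lt_of_le h2 h1 (by positivity)
    have h4 : 2 ≤ 2 ^ (RB g n + g + (n + 1) ^ 2) := by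
      calc (2 : ℕ) = 2 ^ 1 := rfl
        _ ≤ 2 ^ (RB g n + g + (n + 1) ^ 2) := Nat.pow_le_pow_right (by norm_num) (by unfold RB; omega)
    rw [← pow_add, ← add_assoc] at h3
    rw [pow_succ]
    omega
  calc (3 * g * (n + 1).factorial) ^ T * (2 + T * (g * (n + 1).factorial + 1))
      < 2 ^ ((2 * g + (n + 1) ^ 2) * RB g n) * 2 ^ (RB g n + g + (n + 1) ^ 2 + 1) :=
        Nat.mul_lt_mul_of_le_of_lt hpow hsecond (by positivity)
    _ = 2 ^ ((2 * g + (n + 1) ^ 2) * RB g n + (RB g n + g + (n + 1) ^ 2 + 1)) := by rw [← pow_add]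

/-- `EBits` is monotone. [folklore] -/
theorem EBits_mono {m n : ℕ} (h : m ≤ n) : EBits g m ≤ EBits g n := by
  unfold EBits
  have h1 := RB_mono (g := g) h
  have h2 : (m + 1) ^ 2 ≤ (n + 1) ^ 2 := Nat.pow_le_pow_left (by omega) 2
  have h3 : (2 * g + (m + 1) ^ 2) * RB g m ≤ (2 * g + (n + 1) ^ 2) * RB g n := Nat.mul_le_mul (by omega) h1
  omega

/-- **The entry bound by level, in bits**: `EBn g n < 2^{EBits g n}`. [folklore] -/
theorem EBn_lt_two_pow (hg : 1 ≤ g) : ∀ n : ℕ, EBn g n < 2 ^ EBits g n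
  | 0 => by simp [EBn]
  | n + 1 => (EB_lt_two_pow hg n).trans_le (Nat.pow_le_pow_right (by norm_num) (EBits_mono (Nat.le_succ n)))

/-! ### Lengths of codes -/

/-- `|encodeNat n| ≤ b` when `n < 2^b` (from `TM2Pass.length_encodeNat_eq_size`). Twin of
`Literature.Computability.Cryptography.length_encodeNat_le_of_lt` (`Cryptography/ShorClassicalOracle.lean`) and of
`length_encodeNat_le_iff` (`AlgebraicComplexity/RealTauConjectureDefinable.lean`), neither importable
here; librarian: hoist one copy next to `TM2Pass.length_encodeNat_eq_size`. [folklore] -/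
theorem length_encodeNat_le_of_lt_two_pow {n b : ℕ} (h : n < 2 ^ b) : (encodeNat n).length ≤ b := by
  rw [TM2Pass.length_encodeNat_eq_size]
  exact Nat.size_le.2 h

/-- **Length of a list code**: `|listBool e l| ≤ 2|l| + 2 + |l| (2b + 2)` when every item code has
length `≤ b`. [Arora–Barak 2009, §0.1] [cite: AroraBarak2009, §0.1] -/
theorem length_listBool_encode_le {α : Type} (e : Encoding α Bool) (l : List α) (b : ℕ)
    (h : ∀ a ∈ l, (e.encode a).length ≤ b) :
    (e.listBool.encode l).length ≤ 2 * l.length + 2 + l.length * (2 * b + 2) := by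
  have hfold : ∀ l : List α, (∀ a ∈ l, (e.encode a).length ≤ b) →
      (l.foldr (fun a acc => boolPair (e.encode a) acc) []).length ≤ l.length * (2 * b + 2) := by
    intro l
    induction l with
    | nil => intro _; simp
    | cons a l ih =>
      intro hl
      simp only [List.foldr_cons, length_boolPair, List.length_cons]
      have h1 := hl a List.mem_cons_self
      have h2 := ih fun a' ha' => hl a' (List.mem_cons_of_mem _ ha')
      rw [add_mul, one_mul]
      omega
  show (boolPair (unaryEncodeNat l.length) (l.foldr (fun a acc => boolPair (e.encode a) acc) [])).length ≤ _
  rw [length_boolPair]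
  have hu : (unaryEncodeNat l.length).length = l.length := unary_decode_encode_nat _
  have := hfold l h
  omega

/-- **Length of an integer code**: `|encodingIntBool z| ≤ b + 4` when `|z| < 2^b`. [Arora–Barak 2009, §0.1] [cite: AroraBarak2009, §0.1] -/
theorem length_encodingIntBool_le {z : ℤ} {b : ℕ} (h : z.natAbs < 2 ^ b) : (encodingIntBool.encode z).length ≤ b + 4 := by
  show (boolPair (encodingBoolBool.encode (decide (z < 0))) (encodingNatBool.encode z.natAbs)).length ≤ _
  rw [length_boolPair]
  have h1 : (encodingNatBool.encode z.natAbs).length ≤ b := length_encodeNat_le_of_lt_two_pow h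
  have h2 : (encodingBoolBool.encode (decide (z < 0))).length = 1 := rfl
  omega

/-- A polynomial bound for the code length of an `m × m` integer matrix with `b`-bit entries. [folklore] -/
def LM (m b : ℕ) : ℕ := 2 * (m + 1) + 2 + (2 * m + 2 + m * (2 * (2 * m + 2 + m * (2 * (b + 4) + 2)) + 2))

/-- `LM` is monotone in both arguments. [folklore] -/
theorem LM_mono {m m' b b' : ℕ} (hm : m ≤ m') (hb : b ≤ b') : LM m b ≤ LM m' b' := by
  unfold LM
  have h1 : m * (2 * (b + 4) + 2) ≤ m' * (2 * (b' + 4) + 2) := Nat.mul_le_mul hm (by omega)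
  have h2 : m * (2 * (2 * m + 2 + m * (2 * (b + 4) + 2)) + 2) ≤ m' * (2 * (2 * m' + 2 + m' * (2 * (b' + 4) + 2)) + 2) :=
    Nat.mul_le_mul hm (by omega)
  omega

/-- **The code of a square integer matrix has polynomial length**: `|⟨m, M⟩| ≤ LM m b` when all
entries are `< 2^b` in absolute value. [Arora–Barak 2009, §0.1] [cite: AroraBarak2009, §0.1] -/
theorem length_encode_matrix_le {m b : ℕ} (M : Fin m → Fin m → ℤ) (hM : ∀ i j, (M i j).natAbs < 2 ^ b) :
    (encodingIntMatrix.encode ⟨m, M⟩).length ≤ LM m b := by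
  show (boolPair (encodeNat m) ((encodingFinVec (encodingFinVec encodingIntBool m) m).encode M)).length ≤ _
  rw [length_boolPair]
  have hm : (encodeNat m).length ≤ m + 1 := TM2Pass.length_encodeNat_le_self m
  have hrow : ∀ i : Fin m, ((encodingFinVec encodingIntBool m).encode (M i)).length ≤ 2 * m + 2 + m * (2 * (b + 4) + 2) := by
    intro i
    show (encodingIntBool.listBool.encode (List.ofFn (M i))).length ≤ _
    refine (length_listBool_encode_le _ _ (b + 4) fun a ha => ?_).trans (by simp)
    obtain ⟨j, rfl⟩ := (List.mem_ofFn' _ _).1 ha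
    exact length_encodingIntBool_le (hM i j)
  have hmat : ((encodingFinVec (encodingFinVec encodingIntBool m) m).encode M).length ≤
      2 * m + 2 + m * (2 * (2 * m + 2 + m * (2 * (b + 4) + 2)) + 2) := by
    show ((encodingFinVec encodingIntBool m).listBool.encode (List.ofFn M)).length ≤ _
    refine (length_listBool_encode_le _ _ (2 * m + 2 + m * (2 * (b + 4) + 2)) fun a ha => ?_).trans (by simp)
    obtain ⟨i, rfl⟩ := (List.mem_ofFn' _ _).1 ha
    exact hrow i
  unfold LM
  omega

/-- The code of an `m × m` matrix has length `≥ m` (the unary row count). [folklore] -/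
theorem le_length_encode_matrix {m : ℕ} (M : Fin m → Fin m → ℤ) : m ≤ (encodingIntMatrix.encode ⟨m, M⟩).length := by
  show m ≤ (boolPair (encodeNat m) (boolPair (unaryEncodeNat (List.ofFn M).length) _)).length
  rw [length_boolPair, length_boolPair, List.length_ofFn]
  have hu : (unaryEncodeNat m).length = m := unary_decode_encode_nat m
  omega

/-- **On every run, the matrices asked by the search of a `0/1` matrix have polynomially long
codes**: size in `[1, n]`, entries below `2^{EBits g n}`, hence code length `≤ LM n (EBits g n)`.
[cite: AaronsonArkhipovToC2013, proof of Thm. 4.3 (pp. 176–177)] -/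
theorem queries_perLevel_bounded {mk : Maker} (hg : 1 ≤ g) {n : ℕ} {X : Matrix (Fin n) (Fin n) ℤ} (hX : IsZeroOne X)
    (O : Oracle) {q : List Bool} (hq : q ∈ queryList O (perLevel mk g n X)) :
    ∃ (i : Site) (m : ℕ) (M : Fin m → Fin m → ℤ), q = mk i ⟨m, M⟩ ∧ 1 ≤ m ∧ m ≤ n ∧
      (encodingIntMatrix.encode ⟨m, M⟩).length ≤ LM n (EBits g n) := by
  obtain ⟨i, m, M, rfl, h1, h2, h3⟩ := perLevel_QB hg n X hX O _ hq
  refine ⟨i, m, M, rfl, h1, h2, (length_encode_matrix_le M fun a b => ?_).trans (LM_mono h2 le_rfl)⟩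
  have hab := h3 a b
  have hE := EBn_lt_two_pow hg n
  have : ((M a b).natAbs : ℤ) ≤ EBn g n := by rw [Int.natCast_natAbs]; exact hab
  omega

end Bounds

end PerSearch

end Literature.Computability.QuantumComplexity
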